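import Summits.QuantumFields.YangMills.Theorems.FemtoCutoffLadderAssemblyTelescopingR1

/-!
# Femto transfer gap — THE DYADIC LADDER (rev-5/6 shape of route `FemtoCutoffLadder`): ONE bounded incommensurable step `L → M·2^j`,
# the exact nested chain `M·2^j → … → M` with summable (R1-repaired) defects, the coarse pair `(M, 1)`, the one-site anchor

Lead seat `ym-line-fcl-p1` (2026-08-28).  Route rev 5/6 (owner ym-idea-1 g2) replaced the uniform step over all pairs `L' ≤ L ≤ 2L'` by two
strictly weaker cruxes: `OctaveStepDecay` (NESTED pairs `L = 2L'`, summable defect `CΛ²/L'^σ`) and `SubOctaveBounded` (incommensurable pairs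
`L' ≤ L < 2L'`, merely BOUNDED defect `CΛ²`, used once per lattice).  The nested step as typed inherits the matched-two-loop-label defect
(three-loop scaling, `q(SU(2)) = +0.08324` [cite: AllesFeoPanagopoulos1997, eq. (3.7)]; evidence `Cruxes/UniformStepScaling/Misstated.md`),
so this module proves the telescoping for the nested step WITH the telescoping allowance `D(1/β' − 1/β)` (repair R1, `D ≥ 0`); the typed form is
the case `D = 0`.

★ `femtoGapOfRecord_of_dyadicLadder` — (hO) nested octave step with slack `exp(CΛ²/L'^σ + D(1/β' − 1/β))` above `L₀`; (hB) one bounded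
incommensurable step with slack `exp(C_BΛ²)` above `L₀'`; (hP) coarse pairs `(L,1)`; (hA) anchor; (hM) deep-window matching ⟹ `FemtoGapOfRecord`.

THE ARGUMENT.  `M := max(L₀, L₀') + 1`.  (i) Chain (induction on `j`): every window point on the lattice `M·2^j` obeys
`a ≤ exp(−ε₁Λ + Φ(M2^j)Λ² + D(Λ³/2 − 1/β))·b`, `Φ(m) = K₀ + (C⁺/κ)(1 − m^{−σ})`, `κ = 1 − 2^{−σ}`, `K₀ = |C_a| + Σ_{L≤M}|C_L|` — base: coarse pair
`(M,1)` + anchor; step: nested octave `(M2^{j+1}, M2^j)`, the slack `C·(M2^j)^{−σ}` is paid by `Φ(2m') − Φ(m') = C⁺ m'^{−σ}`, the partner's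
`−D/β'` cancels the step's `+D/β'`.  (ii) Any `L`: if `L < M`, coarse pair + anchor; if `L ≥ M`, `j := log₂⌊L/M⌋`, one bounded step
`(L, M2^j)` then (i); budget `D(Λ³/2 − 1/β') ≤ (D/2)Λ²`.  (iii) `L`-th roots.  Output `C = max(C_B,0) + K₀ + C⁺/κ + D/2`, `L₀(lam) = 0`.

HONEST FRAMING: bookkeeping only; neither step nor the fixed-lattice leaf is proved here; R2b1 is a RECORD rung — not infinite volume, not a
mass gap, not Clay.  No definitions, no named facts, no `sorry`.
-/

set_option autoImplicit false

noncomputable section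

namespace Summit.QuantumFields.YangMills.Theorems.FemtoTransferGap.CutoffLadder

open Real
open Summit.QuantumFields.YangMills.Theorems.FemtoTransferGap
open Literature.Analysis.OperatorTheory.YMMatrixModel (luscherEps1)

/-- Exact dyadic contraction of the potential: `w(2m) = 2^{−σ}·w(m)` (stated as `≤`). [folklore] -/
theorem potential_half (σ : ℝ) {m : ℕ} (hm : 0 < m) :
    (((2 * m : ℕ) : ℝ) ^ σ)⁻¹ ≤ (1 / 2 : ℝ) ^ σ * (((m : ℕ) : ℝ) ^ σ)⁻¹ := by
  have hmr : (0 : ℝ) < m := by exact_mod_cast hm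
  have hq : (1 / 2 : ℝ) ^ σ = ((2 : ℝ) ^ σ)⁻¹ := by
    rw [← Real.inv_rpow (by norm_num : (0 : ℝ) ≤ 2)]; norm_num
  rw [hq, ← mul_inv, ← Real.mul_rpow (by norm_num) hmr.le]
  push_cast
  exact le_rfl

/-- Dyadic bracketing: for `M ≥ 1` and `L ≥ M` there is `j` with `M·2^j ≤ L < 2·(M·2^j)`. [folklore] -/
theorem exists_dyadic_bracket {M L : ℕ} (hM : 0 < M) (hL : M ≤ L) :
    ∃ j : ℕ, M * 2 ^ j ≤ L ∧ L < 2 * (M * 2 ^ j) := by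
  set n : ℕ := L / M with hn
  have hn0 : n ≠ 0 := by
    rw [hn]; exact (Nat.div_pos hL hM).ne'
  refine ⟨Nat.log 2 n, ?_, ?_⟩
  · calc M * 2 ^ Nat.log 2 n ≤ M * n := Nat.mul_le_mul_left M (Nat.pow_log_le_self 2 hn0)
      _ ≤ L := by rw [hn]; exact Nat.mul_div_le L M
  · have h1 : L < M * (n + 1) := by rw [hn]; exact Nat.lt_mul_div_succ L hM
    have h2 : n + 1 ≤ 2 ^ (Nat.log 2 n + 1) := Nat.lt_pow_succ_log_self (by norm_num) n
    calc L < M * (n + 1) := h1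
      _ ≤ M * 2 ^ (Nat.log 2 n + 1) := Nat.mul_le_mul_left M h2
      _ = 2 * (M * 2 ^ Nat.log 2 n) := by ring

/-- ★ **THE DYADIC LADDER.**  (hO) NESTED octave step `L = 2L'`, `L' ≥ L₀`, slack `exp(CΛ²/L'^σ + D(1/β' − 1/β))`, `D ≥ 0` (R1-repaired;
the typed `OctaveStepDecay` is `D = 0`); (hB) ONE bounded incommensurable step `L' ≤ L < 2L'`, `L' ≥ L₀'`, slack `exp(C_BΛ²)`; (hP) coarse
pairs `(L, 1)`; (hA) one-site anchor; (hM) deep-window matching (`lam ≤ 1/2`) ⟹ the rung leaf `FemtoGapOfRecord`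
(`C = max(C_B,0) + |C_a| + Σ_{L ≤ M}|C_L| + max(C,0)/(1 − 2^{−σ}) + D/2`, `M = max(L₀,L₀') + 1`, `L₀(lam) = 0`).
[cite: LuscherWeiszWolff1991] [cite: AllesFeoPanagopoulos1997, eq. (3.7)] -/
theorem femtoGapOfRecord_of_dyadicLadder
    (hO : ∃ (C σ D lam0 : ℝ) (L0 : ℕ), 0 < σ ∧ 0 < lam0 ∧ 0 ≤ D ∧ ∀ lam : ℝ, 0 < lam → lam ≤ lam0 →
      ∀ (L' : ℕ) [NeZero L'] (L : ℕ) [NeZero L], L0 ≤ L' → L = 2 * L' →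
        ∀ β β' : ℝ, InFemtoWindow lam β L → InFemtoWindow lam β' L' → luscherLambda β L = luscherLambda β' L' →
          secondValue su2Rep L β ^ L * topValue su2Rep L' β' ^ L' ≤
            Real.exp (C * luscherLambda β L ^ 2 / (L' : ℝ) ^ σ + D * (1 / β' - 1 / β)) *
              (secondValue su2Rep L' β' ^ L' * topValue su2Rep L β ^ L))
    (hB : ∃ (C lam0 : ℝ) (L0 : ℕ), 0 < lam0 ∧ ∀ lam : ℝ, 0 < lam → lam ≤ lam0 →
      ∀ (L' : ℕ) [NeZero L'] (L : ℕ) [NeZero L], L0 ≤ L' → L' ≤ L → L < 2 * L' →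
        ∀ β β' : ℝ, InFemtoWindow lam β L → InFemtoWindow lam β' L' → luscherLambda β L = luscherLambda β' L' →
          secondValue su2Rep L β ^ L * topValue su2Rep L' β' ^ L' ≤
            Real.exp (C * luscherLambda β L ^ 2) * (secondValue su2Rep L' β' ^ L' * topValue su2Rep L β ^ L))
    (hP : ∀ (L : ℕ) [NeZero L], ∃ C lam0 : ℝ, 0 < lam0 ∧ ∀ lam : ℝ, 0 < lam → lam ≤ lam0 →
      ∀ β β' : ℝ, InFemtoWindow lam β L → InFemtoWindow lam β' 1 → luscherLambda β L = luscherLambda β' 1 →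
        secondValue su2Rep L β ^ L * topValue su2Rep 1 β' ^ 1 ≤
          Real.exp (C * luscherLambda β L ^ 2) * (secondValue su2Rep 1 β' ^ 1 * topValue su2Rep L β ^ L))
    (hA : ∃ C lam0 : ℝ, 0 < lam0 ∧ ∀ lam : ℝ, 0 < lam → lam ≤ lam0 → ∀ β : ℝ, InFemtoWindow lam β 1 →
      secondValue su2Rep 1 β ≤ Real.exp (-(zLower C β 1)) * topValue su2Rep 1 β)
    (hM : ∀ lam : ℝ, 0 < lam → lam ≤ 1 / 2 → ∀ (L : ℕ) [NeZero L] (L' : ℕ) [NeZero L'] (β : ℝ),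
      InFemtoWindow lam β L → ∃ β' : ℝ, InFemtoWindow lam β' L' ∧ luscherLambda β' L' = luscherLambda β L) :
    FemtoGapOfRecord := by
  obtain ⟨Co, σ, D, lamO, L0o, hσ, hlamO, hD, HO⟩ := hO
  obtain ⟨Cb, lamB, L0b, hlamB, HB⟩ := hB
  obtain ⟨Ca, lamA, hlamA, HA⟩ := hA
  choose Cp lamP hlamP HP using fun n : ℕ => hP (n + 1)
  -- the chain bottom `M`, and the merged constants
  set M : ℕ := max L0o L0b + 1 with hMdef
  have hMpos : 0 < M := Nat.succ_pos _
  have hML0o : L0o ≤ M := (le_max_left _ _).trans (Nat.le_succ _)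
  have hML0b : L0b ≤ M := (le_max_right _ _).trans (Nat.le_succ _)
  have hne : (Finset.range M).Nonempty := ⟨0, Finset.mem_range.mpr hMpos⟩
  set Cop : ℝ := max Co 0 with hCop
  have hCop0 : 0 ≤ Cop := le_max_right _ _
  have hCole : Co ≤ Cop := le_max_left _ _
  set Cbp : ℝ := max Cb 0 with hCbp
  have hCbp0 : 0 ≤ Cbp := le_max_right _ _
  have hCble : Cb ≤ Cbp := le_max_left _ _
  set q : ℝ := (1 / 2 : ℝ) ^ σ with hq_def
  have hq1 : q < 1 := Real.rpow_lt_one (by norm_num) (by norm_num) hσ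
  set κ : ℝ := 1 - q with hκ_def
  have hκ : 0 < κ := by rw [hκ_def]; linarith
  have hqκ : q = 1 - κ := by rw [hκ_def]; ring
  set Msum : ℝ := ∑ n ∈ Finset.range M, |Cp n| with hMsum_def
  set K0 : ℝ := |Ca| + Msum with hK0
  set Ctot : ℝ := Cbp + K0 + Cop / κ + D / 2 with hCtot
  set lamPmin : ℝ := (Finset.range M).inf' hne lamP with hlamPmin_def
  have hlamPmin : 0 < lamPmin := (Finset.lt_inf'_iff hne).mpr fun n _ => hlamP n
  -- potential and running constant along the chain
  let w : ℕ → ℝ := fun m => (((m : ℕ) : ℝ) ^ σ)⁻¹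
  let Φ : ℕ → ℝ := fun m => K0 + Cop / κ * (1 - w m)
  have hw0 : ∀ m : ℕ, 0 ≤ w m := fun m => inv_nonneg.mpr (Real.rpow_nonneg (Nat.cast_nonneg m) σ)
  have hw1 : ∀ m : ℕ, 0 < m → w m ≤ 1 := fun m hm => by
    haveI : NeZero m := ⟨Nat.pos_iff_ne_zero.mp hm⟩
    exact potential_le_one hσ.le m
  have hΦle : ∀ m : ℕ, Φ m ≤ K0 + Cop / κ := fun m => by
    have hck : 0 ≤ Cop / κ := div_nonneg hCop0 hκ.le
    have : Cop / κ * (1 - w m) ≤ Cop / κ := by nlinarith [hw0 m]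
    show K0 + Cop / κ * (1 - w m) ≤ K0 + Cop / κ
    linarith
  have hΦge : ∀ m : ℕ, 0 < m → K0 ≤ Φ m := fun m hm => by
    have : 0 ≤ Cop / κ * (1 - w m) := mul_nonneg (div_nonneg hCop0 hκ.le) (by linarith [hw1 m hm])
    show K0 ≤ K0 + Cop / κ * (1 - w m)
    linarith
  refine ⟨Ctot, min (min lamO lamB) (min lamA (min lamPmin (1 / 2))),
    lt_min (lt_min hlamO hlamB) (lt_min hlamA (lt_min hlamPmin (by norm_num))), ?_⟩
  intro lam hlam hle
  have hleO : lam ≤ lamO := hle.trans ((min_le_left _ _).trans (min_le_left _ _))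
  have hleB : lam ≤ lamB := hle.trans ((min_le_left _ _).trans (min_le_right _ _))
  have hleA : lam ≤ lamA := hle.trans ((min_le_right _ _).trans (min_le_left _ _))
  have hleP : lam ≤ lamPmin := hle.trans ((min_le_right _ _).trans ((min_le_right _ _).trans (min_le_left _ _)))
  have hhalf : lam ≤ 1 / 2 := hle.trans ((min_le_right _ _).trans ((min_le_right _ _).trans (min_le_right _ _)))
  -- coarse pair + anchor on any lattice `n + 1 ≤ M`: exponent `−ε₁Λ + K0·Λ²`
  have base : ∀ n : ℕ, n + 1 ≤ M → ∀ β : ℝ, InFemtoWindow lam β (n + 1) →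
      secondValue su2Rep (n + 1) β ^ (n + 1) ≤
        Real.exp (-(luscherEps1 * luscherLambda β (n + 1)) + K0 * luscherLambda β (n + 1) ^ 2) *
          topValue su2Rep (n + 1) β ^ (n + 1) := by
    intro n hn β hW
    set Λ : ℝ := luscherLambda β (n + 1) with hΛ
    have hb : 0 ≤ topValue su2Rep (n + 1) β ^ (n + 1) := pow_nonneg (topValue_su2Rep_pos (n + 1) β).le _
    have hnr : n ∈ Finset.range M := Finset.mem_range.mpr (by omega)
    have hleP' : lam ≤ lamP n := hleP.trans (Finset.inf'_le lamP hnr)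
    obtain ⟨β', hW', hmatch⟩ := hM lam hlam hhalf (n + 1) 1 β hW
    have h1 := HP n lam hlam hleP' β β' hW hW' hmatch.symm
    simp only [pow_one] at h1
    have h2 := HA lam hlam hleA β' hW'
    have hb' : 0 < topValue su2Rep 1 β' := topValue_su2Rep_pos 1 β'
    have h3 := le_of_pair_of_partner hb' hb h1 h2
    refine h3.trans (exp_mul_le_exp_mul ?_ hb)
    have hz : zLower Ca β' 1 = luscherEps1 * Λ - Ca * Λ ^ 2 := by
      show luscherEps1 * luscherLambda β' 1 - Ca * luscherLambda β' 1 ^ 2 = _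
      rw [hmatch]
    rw [hz]
    have hCpM : Cp n ≤ Msum := (le_abs_self _).trans (Finset.single_le_sum (fun m _ => abs_nonneg (Cp m)) hnr)
    have hCa : Ca ≤ |Ca| := le_abs_self _
    have hsum : (Cp n + Ca) * Λ ^ 2 ≤ K0 * Λ ^ 2 := mul_le_mul_of_nonneg_right (by linarith) (sq_nonneg Λ)
    linarith
  -- ### (i) the nested chain `M·2^j`
  have chain : ∀ j : ℕ, ∀ (m : ℕ) [NeZero m], m = M * 2 ^ j → ∀ β : ℝ, InFemtoWindow lam β m →
      secondValue su2Rep m β ^ m ≤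
        Real.exp (-(luscherEps1 * luscherLambda β m) + Φ m * luscherLambda β m ^ 2 +
            D * (luscherLambda β m ^ 3 / 2 - 1 / β)) * topValue su2Rep m β ^ m := by
    intro j
    induction j with
    | zero =>
      intro m _ hm β hW
      have hmM : m = M := by rw [hm]; ring
      obtain ⟨n, rfl⟩ : ∃ n, m = n + 1 := Nat.exists_eq_succ_of_ne_zero (NeZero.ne m)
      have hb : 0 ≤ topValue su2Rep (n + 1) β ^ (n + 1) := pow_nonneg (topValue_su2Rep_pos (n + 1) β).le _
      have h := base n (by omega) β hW
      refine h.trans (exp_mul_le_exp_mul ?_ hb)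
      have hbud : 0 ≤ D * (luscherLambda β (n + 1) ^ 3 / 2 - 1 / β) :=
        mul_nonneg hD (by linarith [inv_le_half_luscherLambda_cube hlam hW])
      have hK : K0 * luscherLambda β (n + 1) ^ 2 ≤ Φ (n + 1) * luscherLambda β (n + 1) ^ 2 :=
        mul_le_mul_of_nonneg_right (hΦge (n + 1) (Nat.succ_pos n)) (sq_nonneg _)
      linarith
    | succ j ih =>
      intro m _ hm β hW
      set m' : ℕ := M * 2 ^ j with hm'
      have hm'pos : 0 < m' := by positivity
      haveI : NeZero m' := ⟨hm'pos.ne'⟩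
      have hmm' : m = 2 * m' := by rw [hm, hm', pow_succ]; ring
      have hL0 : L0o ≤ m' := hML0o.trans (by
        calc M = M * 2 ^ 0 := by ring
          _ ≤ M * 2 ^ j := Nat.mul_le_mul_left M (Nat.one_le_two_pow))
      set Λ : ℝ := luscherLambda β m with hΛ
      have hb : 0 ≤ topValue su2Rep m β ^ m := pow_nonneg (topValue_su2Rep_pos m β).le _
      obtain ⟨β', hW', hmatch⟩ := hM lam hlam hhalf m m' β hW
      have h1 := HO lam hlam hleO m' m hL0 hmm' β β' hW hW' hmatch.symm
      have h2 := ih m' rfl β' hW'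
      have hb' : 0 < topValue su2Rep m' β' ^ m' := pow_pos (topValue_su2Rep_pos m' β') _
      have h3 := le_of_pair_of_partner hb' hb h1 h2
      refine h3.trans (exp_mul_le_exp_mul ?_ hb)
      rw [hmatch]
      have hslack : Co * Λ ^ 2 / ((m' : ℕ) : ℝ) ^ σ = Co * w m' * Λ ^ 2 := by
        show Co * Λ ^ 2 / ((m' : ℕ) : ℝ) ^ σ = Co * (((m' : ℕ) : ℝ) ^ σ)⁻¹ * Λ ^ 2
        ring
      rw [hslack]
      have hcontr : w m ≤ q * w m' := by
        show (((m : ℕ) : ℝ) ^ σ)⁻¹ ≤ (1 / 2 : ℝ) ^ σ * (((m' : ℕ) : ℝ) ^ σ)⁻¹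
        rw [hmm']
        exact potential_half σ hm'pos
      have hbudget := step_budget hCole hCop0 hκ hqκ (hw0 m') hcontr
      have hΦm : Φ m = K0 + Cop / κ * (1 - w m) := rfl
      have hΦm' : Φ m' = K0 + Cop / κ * (1 - w m') := rfl
      rw [hΦm, hΦm']
      have hsplit : D * (Λ ^ 3 / 2 - 1 / β') = D * (Λ ^ 3 / 2) - D * (1 / β') := by ring
      have hsplit2 : D * (Λ ^ 3 / 2 - 1 / β) = D * (Λ ^ 3 / 2) - D * (1 / β) := by ring
      have hsplit3 : D * (1 / β' - 1 / β) = D * (1 / β') - D * (1 / β) := by ring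
      have hprod : (Co * w m' + (K0 + Cop / κ * (1 - w m'))) * Λ ^ 2 ≤ (K0 + Cop / κ * (1 - w m)) * Λ ^ 2 :=
        mul_le_mul_of_nonneg_right (by linarith) (sq_nonneg Λ)
      have hexp : (Co * w m' + (K0 + Cop / κ * (1 - w m'))) * Λ ^ 2 =
          Co * w m' * Λ ^ 2 + (K0 + Cop / κ * (1 - w m')) * Λ ^ 2 := by ring
      rw [hsplit3, hsplit, hsplit2]
      linarith [hprod, hexp]
  -- ### (ii) any lattice, then (iii) `L`-th roots; `L₀(lam) = 0`
  refine ⟨0, ?_⟩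
  intro L _ _ β hW
  have hΛ0 : 0 ≤ luscherLambda β L := hlam.le.trans hW.2.1
  have hΛ1 : luscherLambda β L ≤ 1 := hW.2.2.trans (by linarith)
  have hβ0 : 0 < β := by linarith [hW.1]
  have hcube : luscherLambda β L ^ 3 ≤ luscherLambda β L ^ 2 := by
    calc luscherLambda β L ^ 3 = luscherLambda β L ^ 2 * luscherLambda β L := by ring
      _ ≤ luscherLambda β L ^ 2 * 1 := mul_le_mul_of_nonneg_left hΛ1 (sq_nonneg _)
      _ = luscherLambda β L ^ 2 := mul_one _
  have hb : 0 ≤ topValue su2Rep L β ^ L := pow_nonneg (topValue_su2Rep_pos L β).le _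
  have hck : 0 ≤ Cop / κ := div_nonneg hCop0 hκ.le
  -- the pow-level bound with the total constant
  have hpow : secondValue su2Rep L β ^ L ≤ Real.exp (-(zLower Ctot β L)) * topValue su2Rep L β ^ L := by
    by_cases hLM : L < M
    · -- small lattice: coarse pair + anchor
      obtain ⟨n, rfl⟩ : ∃ n, L = n + 1 := Nat.exists_eq_succ_of_ne_zero (NeZero.ne L)
      have h := base n (by omega) β hW
      refine h.trans (exp_mul_le_exp_mul ?_ hb)
      show -(luscherEps1 * luscherLambda β (n + 1)) + K0 * luscherLambda β (n + 1) ^ 2 ≤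
        -(luscherEps1 * luscherLambda β (n + 1) - Ctot * luscherLambda β (n + 1) ^ 2)
      have : K0 * luscherLambda β (n + 1) ^ 2 ≤ Ctot * luscherLambda β (n + 1) ^ 2 :=
        mul_le_mul_of_nonneg_right (by rw [hCtot]; linarith) (sq_nonneg _)
      linarith
    · -- large lattice: one bounded step to `M·2^j`, then the chain
      push Not at hLM
      obtain ⟨j, hmle, hlt⟩ := exists_dyadic_bracket hMpos hLM
      set m : ℕ := M * 2 ^ j with hm
      have hmpos : 0 < m := by positivity
      haveI : NeZero m := ⟨hmpos.ne'⟩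
      have hL0b : L0b ≤ m := hML0b.trans (by
        calc M = M * 2 ^ 0 := by ring
          _ ≤ M * 2 ^ j := Nat.mul_le_mul_left M (Nat.one_le_two_pow))
      obtain ⟨β', hW', hmatch⟩ := hM lam hlam hhalf L m β hW
      have h1 := HB lam hlam hleB m L hL0b hmle hlt β β' hW hW' hmatch.symm
      have h2 := chain j m rfl β' hW'
      have hb' : 0 < topValue su2Rep m β' ^ m := pow_pos (topValue_su2Rep_pos m β') _
      have h3 := le_of_pair_of_partner hb' hb h1 h2
      refine h3.trans (exp_mul_le_exp_mul ?_ hb)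
      rw [hmatch]
      set Λ : ℝ := luscherLambda β L with hΛ
      show Cb * Λ ^ 2 + (-(luscherEps1 * Λ) + Φ m * Λ ^ 2 + D * (Λ ^ 3 / 2 - 1 / β')) ≤ -(luscherEps1 * Λ - Ctot * Λ ^ 2)
      have hβ'0 : 0 < β' := by linarith [hW'.1]
      have hDβ' : 0 ≤ D * (1 / β') := mul_nonneg hD (by positivity)
      have hsplit : D * (Λ ^ 3 / 2 - 1 / β') = D * (Λ ^ 3 / 2) - D * (1 / β') := by ring
      have hDc : D * (Λ ^ 3 / 2) ≤ D / 2 * Λ ^ 2 := by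
        have := mul_le_mul_of_nonneg_left hcube hD
        linarith
      have hsum : (Cb + Φ m) * Λ ^ 2 ≤ (Cbp + K0 + Cop / κ) * Λ ^ 2 :=
        mul_le_mul_of_nonneg_right (by linarith [hΦle m]) (sq_nonneg Λ)
      rw [hsplit]
      have hC : Ctot * Λ ^ 2 = (Cbp + K0 + Cop / κ) * Λ ^ 2 + D / 2 * Λ ^ 2 := by rw [hCtot]; ring
      have hsum' : Cb * Λ ^ 2 + Φ m * Λ ^ 2 = (Cb + Φ m) * Λ ^ 2 := by ring
      linarith [hsum, hDc, hDβ', hC, hsum']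
  exact root_of_pow_le (secondValue_su2Rep_pos (by linarith [hW.1])).le (topValue_su2Rep_pos L β).le hpow

end Summit.QuantumFields.YangMills.Theorems.FemtoTransferGap.CutoffLadder

end
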